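import Summits.Parity.BatemanHorn.Theorems.AlmostPrimeZerosSystemMomentDeficitAssemblyAlgebra

/-!
# Crux `SystemMomentDeficit` (stmt-Parity-11326): two-sided localisation, the blocks

Blocks of the TWO-SIDED localisation of the moment deficit of the capped statistic `s_f` of a
Bateman–Horn system (`AlmostPrimeZerosSystemMomentDeficitLocalisation.lean`):

* `exists_prime_of_not_coprime_of_mem_PP`, `sum_PP_not_coprime_ne_inv_max_le_two` — the
  non-coprime pairs of `PP(z)` (primes `≤ z` and prime squares `≤ z`) are `(p, p)`, `(p², p²)`,
  `(p, p²)`, `(p², p)`;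
* `ablock_ge` — the LOWER bound `E A_z − Var A_z ≥ −O(1)` for the small count
  `A_z = Σ_{i, q ∈ PP(z)} 1[q ∣ fᵢ(n)⁺ ≠ 0]`, `z² ≤ x` (companion of the landed upper bound
  `Ideator3Sketch.ablock_le`): coprime pairs through the UPPER near-pair covariance bound
  `E(1·1') − E1·E1' ≤ C/(x+1)`, same-member same-prime pairs through `E 1_{i,p²} ≤ 2D/p²`,
  cross-member same-prime pairs through Bateman–Horn's resultant argument (no common root of
  `fᵢ, fⱼ` modulo `p > P₀`);
* (the block of a bounded nonnegative variable and Cauchy–Schwarz for the empirical covariance are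
  in `AlmostPrimeZerosSystemMomentDeficitLocalisationCovariance.lean`).

Notation (docstrings only).  `Y = x + 1`, `E g = Y⁻¹ Σ_{0 ≤ n ≤ x} g(n)`,
`Var g = E g² − (E g)²`, `Cov(g, h) = E(gh) − E g · E h`, `PP(z)` = primes `≤ z` ∪ prime squares `≤ z`.
Everything is [folklore].
-/

namespace Summit.Parity.BatemanHorn.Cruxes.SystemMomentDeficit.Localisation

open scoped BigOperators
open Finset Polynomial
open Literature.NumberTheory.Sieve
open Summit.Parity.BatemanHorn.Theorems.AlmostPrimeZeros.SystemMertens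
open Summit.Parity.BatemanHorn.Cruxes.SystemMomentDeficit.Ideator3Sketch

/-! ### Non-coprime pairs of `PP(z)` -/

/-- Two non-coprime elements of `PP(z)` are powers `p` or `p²` (the latter with `p² ≤ z`) of one
prime `p`. [folklore] -/
theorem exists_prime_of_not_coprime_of_mem_PP {z q q' : ℕ}
    (hq : q ∈ (Nat.primesLE z ∪ ((Nat.primesLE z).filter (fun p => p ^ 2 ≤ z)).image (fun p => p ^ 2)))
    (hq' : q' ∈ (Nat.primesLE z ∪ ((Nat.primesLE z).filter (fun p => p ^ 2 ≤ z)).image (fun p => p ^ 2)))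
    (h : ¬ Nat.Coprime q q') :
    ∃ p : ℕ, p.Prime ∧ p ≤ z ∧ (q = p ∨ (q = p ^ 2 ∧ p ^ 2 ≤ z)) ∧ (q' = p ∨ (q' = p ^ 2 ∧ p ^ 2 ≤ z)) := by
  obtain ⟨p, hp, hpq, hpq'⟩ := Nat.Prime.not_coprime_iff_dvd.1 h
  have key : ∀ r : ℕ, r ∈ (Nat.primesLE z ∪ ((Nat.primesLE z).filter (fun p => p ^ 2 ≤ z)).image (fun p => p ^ 2)) → p ∣ r →
      p ≤ z ∧ (r = p ∨ (r = p ^ 2 ∧ p ^ 2 ≤ z)) := by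
    intro r hr hpr
    rcases mem_PP_iff.1 hr with ⟨hrp, hrz⟩ | ⟨s, hs, hsz, rfl⟩
    · have : p = r := (Nat.prime_dvd_prime_iff_eq hp hrp).1 hpr
      subst this
      exact ⟨hrz, Or.inl rfl⟩
    · have h1 : p ∣ s := hp.dvd_of_dvd_pow hpr
      have : p = s := (Nat.prime_dvd_prime_iff_eq hp hs).1 h1
      subst this
      exact ⟨le_trans (Nat.le_self_pow two_ne_zero p) hsz, Or.inr ⟨rfl, hsz⟩⟩
  obtain ⟨hpz, h1⟩ := key q hq hpq
  obtain ⟨-, h2⟩ := key q' hq' hpq'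
  exact ⟨p, hp, hpz, h1, h2⟩

/-- The same-prime off-diagonal mass of `PP(z)`:
`Σ_{(q,q') ∈ PP(z)², ¬coprime, q ≠ q'} 1/max(q,q') ≤ 2` (the pairs are `(p, p²)` and `(p², p)` with
`p² ≤ z`, and `Σ_p 1/p² ≤ 1`). [folklore] -/
theorem sum_PP_not_coprime_ne_inv_max_le_two (z : ℕ) :
    ∑ qq ∈ ((Nat.primesLE z ∪ ((Nat.primesLE z).filter (fun p => p ^ 2 ≤ z)).image (fun p => p ^ 2)) ×ˢ
        (Nat.primesLE z ∪ ((Nat.primesLE z).filter (fun p => p ^ 2 ≤ z)).image (fun p => p ^ 2))).filter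
        (fun qq : ℕ × ℕ => ¬ Nat.Coprime qq.1 qq.2 ∧ qq.1 ≠ qq.2),
      (1 : ℝ) / ((max qq.1 qq.2 : ℕ) : ℝ) ≤ 2 := by
  set S : Finset ℕ := (Nat.primesLE z).filter (fun p => p ^ 2 ≤ z) with hS
  have hsub : ((Nat.primesLE z ∪ ((Nat.primesLE z).filter (fun p => p ^ 2 ≤ z)).image (fun p => p ^ 2)) ×ˢ
        (Nat.primesLE z ∪ ((Nat.primesLE z).filter (fun p => p ^ 2 ≤ z)).image (fun p => p ^ 2))).filter
        (fun qq : ℕ × ℕ => ¬ Nat.Coprime qq.1 qq.2 ∧ qq.1 ≠ qq.2) ⊆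
      S.image (fun p => (p, p ^ 2)) ∪ S.image (fun p => (p ^ 2, p)) := by
    intro qq hqq
    rw [mem_filter, mem_product] at hqq
    obtain ⟨⟨h1, h2⟩, hnc, hne⟩ := hqq
    obtain ⟨p, hp, hpz, hq, hq'⟩ := exists_prime_of_not_coprime_of_mem_PP h1 h2 hnc
    have hpS : ∀ (h : p ^ 2 ≤ z), p ∈ S := fun h =>
      mem_filter.2 ⟨Nat.mem_primesLE.2 ⟨hpz, hp⟩, h⟩
    rw [mem_union, mem_image, mem_image]
    rcases hq with hq | ⟨hq, hz1⟩ <;> rcases hq' with hq' | ⟨hq', hz2⟩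
    · exact absurd (hq.trans hq'.symm) hne
    · exact Or.inl ⟨p, hpS hz2, Prod.ext hq.symm hq'.symm⟩
    · exact Or.inr ⟨p, hpS hz1, Prod.ext hq.symm hq'.symm⟩
    · exact absurd (hq.trans hq'.symm) hne
  have hinj1 : Set.InjOn (fun p : ℕ => (p, p ^ 2)) ↑S := fun a _ b _ hab => (Prod.ext_iff.1 hab).1
  have hinj2 : Set.InjOn (fun p : ℕ => (p ^ 2, p)) ↑S := fun a _ b _ hab => (Prod.ext_iff.1 hab).2
  have hmax : ∀ p ∈ S, max p (p ^ 2) = p ^ 2 ∧ max (p ^ 2) p = p ^ 2 := fun p _ =>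
    ⟨max_eq_right (Nat.le_self_pow two_ne_zero p), max_eq_left (Nat.le_self_pow two_ne_zero p)⟩
  have hsq : ∑ p ∈ S, (1 : ℝ) / (((p ^ 2 : ℕ) : ℕ) : ℝ) ≤ 1 := by
    have := sum_primesLE_sq_inv_le_one z
    refine le_trans (le_of_eq (sum_congr rfl fun p _ => ?_)) this
    push_cast
    ring
  calc ∑ qq ∈ ((Nat.primesLE z ∪ ((Nat.primesLE z).filter (fun p => p ^ 2 ≤ z)).image (fun p => p ^ 2)) ×ˢ
          (Nat.primesLE z ∪ ((Nat.primesLE z).filter (fun p => p ^ 2 ≤ z)).image (fun p => p ^ 2))).filter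
          (fun qq : ℕ × ℕ => ¬ Nat.Coprime qq.1 qq.2 ∧ qq.1 ≠ qq.2),
        (1 : ℝ) / ((max qq.1 qq.2 : ℕ) : ℝ)
      ≤ ∑ qq ∈ S.image (fun p => (p, p ^ 2)) ∪ S.image (fun p => (p ^ 2, p)),
          (1 : ℝ) / ((max qq.1 qq.2 : ℕ) : ℝ) :=
        sum_le_sum_of_subset_of_nonneg hsub fun qq _ _ => by positivity
    _ ≤ ∑ qq ∈ S.image (fun p => (p, p ^ 2)), (1 : ℝ) / ((max qq.1 qq.2 : ℕ) : ℝ) +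
          ∑ qq ∈ S.image (fun p => (p ^ 2, p)), (1 : ℝ) / ((max qq.1 qq.2 : ℕ) : ℝ) :=
        sum_union_le_add fun qq => by positivity
    _ = ∑ p ∈ S, (1 : ℝ) / (((p ^ 2 : ℕ) : ℕ) : ℝ) + ∑ p ∈ S, (1 : ℝ) / (((p ^ 2 : ℕ) : ℕ) : ℝ) := by
        rw [sum_image hinj1, sum_image hinj2]
        congr 1
        · exact sum_congr rfl fun p hp => by rw [(hmax p hp).1]
        · exact sum_congr rfl fun p hp => by rw [(hmax p hp).2]
    _ ≤ 2 := by linarith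

/-! ### Block `E A_z − Var A_z ≥ −O(1)` -/

/-- **Block `E A_z − Var A_z ≥ −O(1)`** (companion of `Ideator3Sketch.ablock_le`).  Pair expansion
over `(univ ×ˢ PP(z))²` of the deficit of the small count `A_z` of a system `f` (`z² ≤ x`):
diagonal terms are `(E 1)² ≥ 0`; coprime pairs (CRT-near) are `≥ −C/(x+1)` by the UPPER near-pair
covariance bound, at most `2(x+1)` of them; a same-member pair `{q, q'} = {p, p²}` is
`≥ −E 1_{i,p²} ≥ −2D/p²`; a cross-member same-prime pair is `≥ −E(1_{p ∣ fᵢ} 1_{p ∣ fⱼ})`, which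
vanishes for `p > P₀` (no common root modulo `p`, Bateman–Horn's resultant argument) and is
`≥ −1 ≥ −(P₀+1)⁴/(qq')` for `p ≤ P₀`. [folklore] -/
theorem ablock_ge :
    ∀ (k : ℕ) (f : Fin k → ℤ[X]) (x z P₀ : ℕ) (Zf : Fin k × ℕ → ℕ → ℝ) (D CpU : ℝ)
    (hD : 0 ≤ D) (hCpU : 0 ≤ CpU) (hzx : z ≤ x) (hzz : z * z ≤ x)
    (hZfdef : ∀ t n, Zf t n =
      if t.2 ∣ ((f t.1).eval (n : ℤ)).toNat ∧ ((f t.1).eval (n : ℤ)).toNat ≠ 0 then 1 else 0)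
    (he : ∀ t : Fin k × ℕ, t.2 ∈ (Nat.primesLE x ∪ ((Nat.primesLE x).filter (fun p => p ^ 2 ≤ x)).image (fun p => p ^ 2)) →
      (∑ n ∈ range (x + 1), Zf t n) / ((x : ℝ) + 1) ≤ 2 * D / (t.2 : ℝ))
    (hpairU : ∀ t t' : Fin k × ℕ, t.2 ∈ (Nat.primesLE x ∪ ((Nat.primesLE x).filter (fun p => p ^ 2 ≤ x)).image (fun p => p ^ 2)) → t'.2 ∈ (Nat.primesLE x ∪ ((Nat.primesLE x).filter (fun p => p ^ 2 ≤ x)).image (fun p => p ^ 2)) → Nat.Coprime t.2 t'.2 →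
      (∑ n ∈ range (x + 1), Zf t n * Zf t' n) / ((x : ℝ) + 1) -
        (∑ n ∈ range (x + 1), Zf t n) / ((x : ℝ) + 1) * ((∑ n ∈ range (x + 1), Zf t' n) / ((x : ℝ) + 1)) ≤
        CpU / ((x : ℝ) + 1))
    (hcross : ∀ i j : Fin k, i ≠ j → ∀ p : ℕ, P₀ < p → ∀ n : ℤ,
      ¬ ((p : ℤ) ∣ (f i).eval n ∧ (p : ℤ) ∣ (f j).eval n))
    (hcnt : #(((Nat.primesLE x ∪ ((Nat.primesLE x).filter (fun p => p ^ 2 ≤ x)).image (fun p => p ^ 2)) ×ˢ (Nat.primesLE x ∪ ((Nat.primesLE x).filter (fun p => p ^ 2 ≤ x)).image (fun p => p ^ 2))).filter (fun qq : ℕ × ℕ => Nat.Coprime qq.1 qq.2 ∧ qq.1 * qq.2 ≤ x)) ≤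
      2 * (x + 1))
    (h8 : ∑ qq ∈ ((Nat.primesLE x ∪ ((Nat.primesLE x).filter (fun p => p ^ 2 ≤ x)).image (fun p => p ^ 2)) ×ˢ (Nat.primesLE x ∪ ((Nat.primesLE x).filter (fun p => p ^ 2 ≤ x)).image (fun p => p ^ 2))).filter (fun qq : ℕ × ℕ => ¬ Nat.Coprime qq.1 qq.2),
      (1 : ℝ) / ((qq.1 : ℝ) * (qq.2 : ℝ)) ≤ 8),
    -((k : ℝ) ^ 2 * (2 * CpU + 8 * ((P₀ : ℝ) + 1) ^ 4 + 4 * D)) ≤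
      (∑ n ∈ range (x + 1), ∑ t ∈ (univ : Finset (Fin k)) ×ˢ (Nat.primesLE z ∪ ((Nat.primesLE z).filter (fun p => p ^ 2 ≤ z)).image (fun p => p ^ 2)), Zf t n) / ((x : ℝ) + 1) -
        (∑ n ∈ range (x + 1), (∑ t ∈ (univ : Finset (Fin k)) ×ˢ (Nat.primesLE z ∪ ((Nat.primesLE z).filter (fun p => p ^ 2 ≤ z)).image (fun p => p ^ 2)), Zf t n) ^ 2) / ((x : ℝ) + 1) +
      ((∑ n ∈ range (x + 1), ∑ t ∈ (univ : Finset (Fin k)) ×ˢ (Nat.primesLE z ∪ ((Nat.primesLE z).filter (fun p => p ^ 2 ≤ z)).image (fun p => p ^ 2)), Zf t n) / ((x : ℝ) + 1)) ^ 2 := by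
  intro k f x z P₀ Zf D CpU hD hCpU hzx hzz hZfdef he hpairU hcross hcnt h8
  classical
  set M₀ : ℝ := ((P₀ : ℝ) + 1) ^ 4 with hM₀
  have hM₀0 : 0 ≤ M₀ := by positivity
  have hY0 : (0 : ℝ) < (x : ℝ) + 1 := by positivity
  have hZf01 : ∀ t n, Zf t n = 0 ∨ Zf t n = 1 := fun t n => by
    rw [hZfdef]; split_ifs <;> simp
  have hZf0 : ∀ t n, 0 ≤ Zf t n := fun t n => by rcases hZf01 t n with h | h <;> simp [h]
  have hZf1 : ∀ t n, Zf t n ≤ 1 := fun t n => by rcases hZf01 t n with h | h <;> simp [h]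
  have hmemx : ∀ t ∈ (univ : Finset (Fin k)) ×ˢ (Nat.primesLE z ∪ ((Nat.primesLE z).filter (fun p => p ^ 2 ≤ z)).image (fun p => p ^ 2)), t.2 ∈ (Nat.primesLE x ∪ ((Nat.primesLE x).filter (fun p => p ^ 2 ≤ x)).image (fun p => p ^ 2)) := fun t ht =>
    PP_mono hzx (mem_product.1 ht).2
  have he0 : ∀ t : Fin k × ℕ, 0 ≤ (∑ n ∈ range (x + 1), Zf t n) / ((x : ℝ) + 1) := fun t =>
    div_nonneg (sum_nonneg fun n _ => hZf0 t n) hY0.le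
  have he2_0 : ∀ t t' : Fin k × ℕ, 0 ≤ (∑ n ∈ range (x + 1), Zf t n * Zf t' n) / ((x : ℝ) + 1) :=
    fun t t' => div_nonneg (sum_nonneg fun n _ => mul_nonneg (hZf0 t n) (hZf0 t' n)) hY0.le
  -- `E(Z_t Z_t') ≤ min (E Z_t, E Z_t')` and `≤ 1`
  have hE2_le_left : ∀ t t' : Fin k × ℕ, (∑ n ∈ range (x + 1), Zf t n * Zf t' n) / ((x : ℝ) + 1) ≤
      (∑ n ∈ range (x + 1), Zf t n) / ((x : ℝ) + 1) := fun t t' =>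
    div_le_div_of_nonneg_right (sum_le_sum fun n _ => by
      have := mul_le_mul_of_nonneg_left (hZf1 t' n) (hZf0 t n)
      simpa using this) hY0.le
  have hE2_le_right : ∀ t t' : Fin k × ℕ, (∑ n ∈ range (x + 1), Zf t n * Zf t' n) / ((x : ℝ) + 1) ≤
      (∑ n ∈ range (x + 1), Zf t' n) / ((x : ℝ) + 1) := fun t t' =>
    div_le_div_of_nonneg_right (sum_le_sum fun n _ => by
      have := mul_le_mul_of_nonneg_right (hZf1 t n) (hZf0 t' n)
      simpa using this) hY0.le
  have hE2_le_one : ∀ t t' : Fin k × ℕ, (∑ n ∈ range (x + 1), Zf t n * Zf t' n) / ((x : ℝ) + 1) ≤ 1 := by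
    intro t t'
    rw [div_le_one hY0]
    calc ∑ n ∈ range (x + 1), Zf t n * Zf t' n ≤ ∑ _n ∈ range (x + 1), (1 : ℝ) :=
          sum_le_sum fun n _ => by
            have := mul_le_mul (hZf1 t n) (hZf1 t' n) (hZf0 t' n) zero_le_one
            simpa using this
      _ = (x : ℝ) + 1 := by rw [sum_const, card_range, nsmul_eq_mul, mul_one]; push_cast; ring
  -- cross-member same-prime products vanish for `p > P₀`
  have hvanish : ∀ (i j : Fin k) (q q' p : ℕ), i ≠ j → p.Prime → P₀ < p → p ∣ q → p ∣ q' →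
      ∀ n : ℕ, Zf (i, q) n * Zf (j, q') n = 0 := by
    intro i j q q' p hij hp hP hpq hpq' n
    rw [hZfdef (i, q) n, hZfdef (j, q') n]
    split_ifs with h1 h2
    · exfalso
      obtain ⟨hpos1, hd1⟩ := dvd_toNat_and_ne_zero_iff.1 h1
      obtain ⟨hpos2, hd2⟩ := dvd_toNat_and_ne_zero_iff.1 h2
      exact hcross i j hij p hP (n : ℤ)
        ⟨(Int.natCast_dvd_natCast.2 hpq).trans hd1, (Int.natCast_dvd_natCast.2 hpq').trans hd2⟩
    · simp
    · simp
    · simp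
  rw [deficit_sum_eq]
  -- termwise lower bound
  have hterm : ∀ t ∈ (univ : Finset (Fin k)) ×ˢ (Nat.primesLE z ∪ ((Nat.primesLE z).filter (fun p => p ^ 2 ≤ z)).image (fun p => p ^ 2)), ∀ t' ∈ (univ : Finset (Fin k)) ×ˢ (Nat.primesLE z ∪ ((Nat.primesLE z).filter (fun p => p ^ 2 ≤ z)).image (fun p => p ^ 2)),
      -(if Nat.Coprime t.2 t'.2 then CpU / ((x : ℝ) + 1)
        else M₀ / ((t.2 : ℝ) * (t'.2 : ℝ)) +
          (if t.2 = t'.2 then 0 else 2 * D / ((max t.2 t'.2 : ℕ) : ℝ))) ≤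
      (∑ n ∈ range (x + 1), Zf t n) / ((x : ℝ) + 1) * ((∑ n ∈ range (x + 1), Zf t' n) / ((x : ℝ) + 1)) -
          (∑ n ∈ range (x + 1), Zf t n * Zf t' n) / ((x : ℝ) + 1) +
        (if t = t' then (∑ n ∈ range (x + 1), Zf t n) / ((x : ℝ) + 1) else 0) := by
    rintro ⟨i, q⟩ ht ⟨j, q'⟩ ht'
    have hqz : q ∈ (Nat.primesLE z ∪ ((Nat.primesLE z).filter (fun p => p ^ 2 ≤ z)).image (fun p => p ^ 2)) := (mem_product.1 ht).2
    have hq'z : q' ∈ (Nat.primesLE z ∪ ((Nat.primesLE z).filter (fun p => p ^ 2 ≤ z)).image (fun p => p ^ 2)) := (mem_product.1 ht').2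
    have htx := hmemx _ ht
    have ht'x := hmemx _ ht'
    simp only at htx ht'x ⊢
    by_cases hcop : Nat.Coprime q q'
    · have hne : ((i, q) : Fin k × ℕ) ≠ (j, q') := by
        intro h
        have hqq : q = q' := (Prod.ext_iff.1 h).2
        subst hqq
        have h2 := (isPrimePow_and_le_of_mem_PP htx).2.1
        rw [Nat.coprime_self] at hcop
        omega
      rw [if_pos hcop, if_neg hne, add_zero]
      linarith [hpairU (i, q) (j, q') htx ht'x hcop]
    · rw [if_neg hcop]
      have hq0 : (0 : ℝ) < q := by
        have := (isPrimePow_and_le_of_mem_PP htx).2.1; exact_mod_cast (by omega)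
      have hq'0 : (0 : ℝ) < q' := by
        have := (isPrimePow_and_le_of_mem_PP ht'x).2.1; exact_mod_cast (by omega)
      have hMqq : 0 ≤ M₀ / ((q : ℝ) * (q' : ℝ)) := by positivity
      obtain ⟨p, hp, hpz, hq, hq'⟩ := exists_prime_of_not_coprime_of_mem_PP hqz hq'z hcop
      have hpq : p ∣ q := by rcases hq with rfl | ⟨rfl, -⟩ <;> simp
      have hpq' : p ∣ q' := by rcases hq' with rfl | ⟨rfl, -⟩ <;> simp
      by_cases heq : ((i, q) : Fin k × ℕ) = (j, q')
      · -- diagonal: `(E Z)² ≥ 0`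
        have hqq : q = q' := (Prod.ext_iff.1 heq).2
        have hij : i = j := (Prod.ext_iff.1 heq).1
        subst hqq; subst hij
        rw [if_pos rfl, if_pos rfl, add_zero]
        have hdiag : ∑ n ∈ range (x + 1), Zf (i, q) n * Zf (i, q) n = ∑ n ∈ range (x + 1), Zf (i, q) n :=
          sum_congr rfl fun n _ => by rcases hZf01 (i, q) n with h | h <;> simp [h]
        rw [hdiag]
        nlinarith [he0 (i, q), hMqq]
      · rw [if_neg heq, add_zero]
        by_cases hij : i = j
        · -- same member, `{q, q'} = {p, p²}`: `E(ZZ') ≤ E Z_{i,p²} ≤ 2D/p²`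
          subst hij
          have hqne : q ≠ q' := fun h => heq (by rw [h])
          rw [if_neg hqne]
          have hp2x : ∀ (h : p ^ 2 ≤ z), p ^ 2 ∈ (Nat.primesLE x ∪ ((Nat.primesLE x).filter (fun p => p ^ 2 ≤ x)).image (fun p => p ^ 2)) :=
            fun h => PP_mono hzx (mem_PP_iff.2 (Or.inr ⟨p, hp, h, rfl⟩))
          have hkey : (∑ n ∈ range (x + 1), Zf (i, q) n * Zf (i, q') n) / ((x : ℝ) + 1) ≤
              2 * D / ((max q q' : ℕ) : ℝ) := by
            rcases hq with rfl | ⟨rfl, hz1⟩ <;> rcases hq' with rfl | ⟨rfl, hz2⟩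
            · exact absurd rfl hqne
            · rw [max_eq_right (Nat.le_self_pow two_ne_zero _)]
              exact (hE2_le_right _ _).trans (he (i, _) (hp2x hz2))
            · rw [max_eq_left (Nat.le_self_pow two_ne_zero _)]
              exact (hE2_le_left _ _).trans (he (i, _) (hp2x hz1))
            · exact absurd rfl hqne
          nlinarith [he0 (i, q), he0 (i, q'), hkey, hMqq]
        · -- cross members, same prime `p`: vanishes for `p > P₀`, else `≤ 1 ≤ M₀/(qq')`
          have hkey : (∑ n ∈ range (x + 1), Zf (i, q) n * Zf (j, q') n) / ((x : ℝ) + 1) ≤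
              M₀ / ((q : ℝ) * (q' : ℝ)) := by
            by_cases hP : P₀ < p
            · have h0 : ∑ n ∈ range (x + 1), Zf (i, q) n * Zf (j, q') n = 0 :=
                sum_eq_zero fun n _ => hvanish i j q q' p hij hp hP hpq hpq' n
              rw [h0, zero_div]
              exact hMqq
            · have hpP : p ≤ P₀ := not_lt.1 hP
              have hqle : q ≤ p ^ 2 := by
                rcases hq with rfl | ⟨rfl, -⟩
                · exact Nat.le_self_pow two_ne_zero _
                · exact le_rfl
              have hq'le : q' ≤ p ^ 2 := by
                rcases hq' with rfl | ⟨rfl, -⟩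
                · exact Nat.le_self_pow two_ne_zero _
                · exact le_rfl
              have hqR : (q : ℝ) ≤ ((P₀ : ℝ) + 1) ^ 2 := by
                have h1 : (q : ℝ) ≤ (p : ℝ) ^ 2 := by exact_mod_cast hqle
                have h2 : (p : ℝ) ≤ (P₀ : ℝ) + 1 := by
                  have : (p : ℝ) ≤ P₀ := by exact_mod_cast hpP
                  linarith
                have h3 : (p : ℝ) ^ 2 ≤ ((P₀ : ℝ) + 1) ^ 2 := by gcongr
                exact h1.trans h3
              have hq'R : (q' : ℝ) ≤ ((P₀ : ℝ) + 1) ^ 2 := by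
                have h1 : (q' : ℝ) ≤ (p : ℝ) ^ 2 := by exact_mod_cast hq'le
                have h2 : (p : ℝ) ≤ (P₀ : ℝ) + 1 := by
                  have : (p : ℝ) ≤ P₀ := by exact_mod_cast hpP
                  linarith
                have h3 : (p : ℝ) ^ 2 ≤ ((P₀ : ℝ) + 1) ^ 2 := by gcongr
                exact h1.trans h3
              have hprod : (q : ℝ) * (q' : ℝ) ≤ M₀ := by
                calc (q : ℝ) * (q' : ℝ) ≤ ((P₀ : ℝ) + 1) ^ 2 * ((P₀ : ℝ) + 1) ^ 2 :=
                      mul_le_mul hqR hq'R hq'0.le (by positivity)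
                  _ = M₀ := by rw [hM₀]; ring
              refine (hE2_le_one _ _).trans ?_
              rw [le_div_iff₀ (mul_pos hq0 hq'0), one_mul]
              exact hprod
          have hsnd : 0 ≤ (if q = q' then (0 : ℝ) else 2 * D / ((max q q' : ℕ) : ℝ)) := by
            split_ifs
            · exact le_rfl
            · positivity
          nlinarith [he0 (i, q), he0 (j, q'), hkey, hsnd]
  refine le_trans ?_ (sum_le_sum fun t ht => sum_le_sum fun t' ht' => hterm t ht t' ht')
  simp only [sum_neg_distrib, neg_le_neg_iff]
  rw [sum_univ_prod_sum_univ_prod (k := k) ((Nat.primesLE z ∪ ((Nat.primesLE z).filter (fun p => p ^ 2 ≤ z)).image (fun p => p ^ 2))) ((Nat.primesLE z ∪ ((Nat.primesLE z).filter (fun p => p ^ 2 ≤ z)).image (fun p => p ^ 2))) (fun q q' =>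
    if Nat.Coprime q q' then CpU / ((x : ℝ) + 1)
    else M₀ / ((q : ℝ) * (q' : ℝ)) + (if q = q' then 0 else 2 * D / ((max q q' : ℕ) : ℝ)))]
  refine mul_le_mul_of_nonneg_left ?_ (by positivity)
  rw [sum_ite]
  -- coprime pairs: at most `2(x+1)` of them
  have hcnt' : (#(((Nat.primesLE z ∪ ((Nat.primesLE z).filter (fun p => p ^ 2 ≤ z)).image (fun p => p ^ 2)) ×ˢ (Nat.primesLE z ∪ ((Nat.primesLE z).filter (fun p => p ^ 2 ≤ z)).image (fun p => p ^ 2))).filter (fun qq : ℕ × ℕ => Nat.Coprime qq.1 qq.2)) : ℝ) ≤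
      2 * ((x : ℝ) + 1) := by
    have h2 : #(((Nat.primesLE z ∪ ((Nat.primesLE z).filter (fun p => p ^ 2 ≤ z)).image (fun p => p ^ 2)) ×ˢ (Nat.primesLE z ∪ ((Nat.primesLE z).filter (fun p => p ^ 2 ≤ z)).image (fun p => p ^ 2))).filter (fun qq : ℕ × ℕ => Nat.Coprime qq.1 qq.2)) ≤
        #(((Nat.primesLE x ∪ ((Nat.primesLE x).filter (fun p => p ^ 2 ≤ x)).image (fun p => p ^ 2)) ×ˢ (Nat.primesLE x ∪ ((Nat.primesLE x).filter (fun p => p ^ 2 ≤ x)).image (fun p => p ^ 2))).filter (fun qq : ℕ × ℕ => Nat.Coprime qq.1 qq.2 ∧ qq.1 * qq.2 ≤ x)) := by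
      refine card_le_card fun qq hqq => ?_
      rw [mem_filter, mem_product] at hqq ⊢
      obtain ⟨⟨h1, h2⟩, hc⟩ := hqq
      refine ⟨⟨PP_mono hzx h1, PP_mono hzx h2⟩, hc, ?_⟩
      exact le_trans (Nat.mul_le_mul (isPrimePow_and_le_of_mem_PP h1).2.2
        (isPrimePow_and_le_of_mem_PP h2).2.2) hzz
    exact_mod_cast h2.trans hcnt
  have hA : ∑ qq ∈ ((Nat.primesLE z ∪ ((Nat.primesLE z).filter (fun p => p ^ 2 ≤ z)).image (fun p => p ^ 2)) ×ˢ (Nat.primesLE z ∪ ((Nat.primesLE z).filter (fun p => p ^ 2 ≤ z)).image (fun p => p ^ 2))).filter (fun qq : ℕ × ℕ => Nat.Coprime qq.1 qq.2),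
      CpU / ((x : ℝ) + 1) ≤ 2 * CpU := by
    rw [sum_const, nsmul_eq_mul]
    calc _ ≤ 2 * ((x : ℝ) + 1) * (CpU / ((x : ℝ) + 1)) :=
          mul_le_mul_of_nonneg_right hcnt' (div_nonneg hCpU hY0.le)
      _ = 2 * CpU := by field_simp
  -- non-coprime pairs: `M₀ ·` harmonic mass `≤ 8`, plus the off-diagonal same-prime mass `≤ 2`
  have hB1 : ∑ qq ∈ ((Nat.primesLE z ∪ ((Nat.primesLE z).filter (fun p => p ^ 2 ≤ z)).image (fun p => p ^ 2)) ×ˢ (Nat.primesLE z ∪ ((Nat.primesLE z).filter (fun p => p ^ 2 ≤ z)).image (fun p => p ^ 2))).filter (fun qq : ℕ × ℕ => ¬ Nat.Coprime qq.1 qq.2),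
      M₀ / ((qq.1 : ℝ) * (qq.2 : ℝ)) ≤ M₀ * 8 := by
    calc ∑ qq ∈ ((Nat.primesLE z ∪ ((Nat.primesLE z).filter (fun p => p ^ 2 ≤ z)).image (fun p => p ^ 2)) ×ˢ (Nat.primesLE z ∪ ((Nat.primesLE z).filter (fun p => p ^ 2 ≤ z)).image (fun p => p ^ 2))).filter (fun qq : ℕ × ℕ => ¬ Nat.Coprime qq.1 qq.2),
          M₀ / ((qq.1 : ℝ) * (qq.2 : ℝ))
        = M₀ * ∑ qq ∈ ((Nat.primesLE z ∪ ((Nat.primesLE z).filter (fun p => p ^ 2 ≤ z)).image (fun p => p ^ 2)) ×ˢ (Nat.primesLE z ∪ ((Nat.primesLE z).filter (fun p => p ^ 2 ≤ z)).image (fun p => p ^ 2))).filter (fun qq : ℕ × ℕ => ¬ Nat.Coprime qq.1 qq.2),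
            (1 : ℝ) / ((qq.1 : ℝ) * (qq.2 : ℝ)) := by
          rw [mul_sum]
          exact sum_congr rfl fun qq _ => by ring
      _ ≤ M₀ * ∑ qq ∈ ((Nat.primesLE x ∪ ((Nat.primesLE x).filter (fun p => p ^ 2 ≤ x)).image (fun p => p ^ 2)) ×ˢ (Nat.primesLE x ∪ ((Nat.primesLE x).filter (fun p => p ^ 2 ≤ x)).image (fun p => p ^ 2))).filter (fun qq : ℕ × ℕ => ¬ Nat.Coprime qq.1 qq.2),
            (1 : ℝ) / ((qq.1 : ℝ) * (qq.2 : ℝ)) := by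
          refine mul_le_mul_of_nonneg_left ?_ hM₀0
          refine sum_le_sum_of_subset_of_nonneg ?_ fun qq _ _ => by positivity
          exact filter_subset_filter _ (product_subset_product (PP_mono hzx) (PP_mono hzx))
      _ ≤ M₀ * 8 := mul_le_mul_of_nonneg_left h8 hM₀0
  have hB2 : ∑ qq ∈ ((Nat.primesLE z ∪ ((Nat.primesLE z).filter (fun p => p ^ 2 ≤ z)).image (fun p => p ^ 2)) ×ˢ (Nat.primesLE z ∪ ((Nat.primesLE z).filter (fun p => p ^ 2 ≤ z)).image (fun p => p ^ 2))).filter (fun qq : ℕ × ℕ => ¬ Nat.Coprime qq.1 qq.2),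
      (if qq.1 = qq.2 then (0 : ℝ) else 2 * D / ((max qq.1 qq.2 : ℕ) : ℝ)) ≤ 2 * D * 2 := by
    rw [sum_ite, sum_const_zero, zero_add, filter_filter]
    calc ∑ qq ∈ ((Nat.primesLE z ∪ ((Nat.primesLE z).filter (fun p => p ^ 2 ≤ z)).image (fun p => p ^ 2)) ×ˢ (Nat.primesLE z ∪ ((Nat.primesLE z).filter (fun p => p ^ 2 ≤ z)).image (fun p => p ^ 2))).filter (fun qq : ℕ × ℕ => ¬ Nat.Coprime qq.1 qq.2 ∧ ¬ qq.1 = qq.2),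
          2 * D / ((max qq.1 qq.2 : ℕ) : ℝ)
        = 2 * D * ∑ qq ∈ ((Nat.primesLE z ∪ ((Nat.primesLE z).filter (fun p => p ^ 2 ≤ z)).image (fun p => p ^ 2)) ×ˢ (Nat.primesLE z ∪ ((Nat.primesLE z).filter (fun p => p ^ 2 ≤ z)).image (fun p => p ^ 2))).filter (fun qq : ℕ × ℕ => ¬ Nat.Coprime qq.1 qq.2 ∧ qq.1 ≠ qq.2),
            (1 : ℝ) / ((max qq.1 qq.2 : ℕ) : ℝ) := by
          rw [mul_sum]
          exact sum_congr rfl fun qq _ => by ring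
      _ ≤ 2 * D * 2 := mul_le_mul_of_nonneg_left (sum_PP_not_coprime_ne_inv_max_le_two z) (by positivity)
  rw [sum_add_distrib]
  linarith

end Summit.Parity.BatemanHorn.Cruxes.SystemMomentDeficit.Localisation
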